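import Literature.Geometry.Lorentzian.CoordTensorWaveOp
import Literature.Geometry.Lorentzian.CoordTensorCovariance
import HarnessLib

/-!
# The lower-order part of the tensor wave operator: linearity in the jets, locality, and the
# Schur complement identity of the slice metric

Coordinate-components support file (everything proved; no named facts), continuing
`CoordTensorWaveOp.lean` (`tlap = principal part + tlapLower`):

* `tlapLower_eq_sum` — `tlapLower` is LINEAR in the jet `(U, P)` (`tlapLowerₗ`), hence
  `tlapLower x U P I = Σ_J U_J · L⁰_{IJ}(x) + Σ_m Σ_J P_{mJ} · L^m_{IJ}(x)` with the explicit smooth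
  coefficient functions `lowerCoef0`, `lowerCoef1` (the zeroth- and first-order coefficients of
  the coupled system `□T = 0`, O'Neill 1983, Ch. 3, Def. 3.50);
* **locality**: if two metrics agree on an open set then `tlap` and `ricAt` agree there
  (`tlap_congr_of_eqOn`, `ricAt_congr_of_eqOn`, complementing `tcov_congr_of_eqOn`,
  `riemAt_congr_of_eqOn` of `CoordTensorCovariance.lean`); if the metric is constant near `x`
  then `chrCoef`, `tcovLower`, `tlapLower`, `lowerCoef0`, `lowerCoef1` vanish at `x`;
* `sum_metric_mul_sliceQ` — the **Schur complement identity**: in a basis indexed by `Option ι`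
  (`none` = time) the spatial symbol `Q^{jk} = g^{jk} − g^{0j}g^{0k}/g⁰⁰` is the inverse of the
  spatial block `(g_{jk})` of the metric (Hawking–Ellis 1973, §2.7; the induced metric of the
  slices `{t = const}`).

## References

* B. O'Neill, *Semi-Riemannian Geometry*, Academic Press 1983, Ch. 3. [ONeill1983]
* S. W. Hawking, G. F. R. Ellis, *The large scale structure of space-time*, CUP 1973, §2.7.
  [HawkingEllis1973CUP]
-/

noncomputable section

-- instance search through nested operator types `E →L E →L ℝ`
set_option maxSynthPendingDepth 3

open Set Filter ContinuousLinearMap Module Function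
open scoped Topology ContDiff

namespace Literature.Geometry.Lorentzian

namespace MetricCoord

variable {E : Type*} [NormedAddCommGroup E] [NormedSpace ℝ E] {ι : Type*}

/-! ### Linearity of the lower-order part in the jets -/

section Linear

variable [Fintype ι] (G : E → E →L[ℝ] E →L[ℝ] ℝ) (b : Basis ι ℝ E) {α : Type*} [Fintype α]
  [DecidableEq α]

/-- The lower-order part of `(∇∇T)_{jkI}` as a linear functional of the jet `(U, P)`.
[cite: ONeill1983, Ch. 3, Def. 3.50] -/
def tcovLowerₗ (x : E) (j k : ι) (I : α → ι) : (((α → ι) → ℝ) × (ι → (α → ι) → ℝ)) →ₗ[ℝ] ℝ where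
  toFun UP := tcovLower G b x UP.1 UP.2 j k I
  map_add' UP UP' := by
    simp only [tcovLower, Prod.fst_add, Prod.snd_add, Pi.add_apply, mul_add, Finset.sum_add_distrib,
      mul_sub, Finset.mul_sum, Finset.sum_sub_distrib]
    ring
  map_smul' c UP := by
    simp only [tcovLower, Prod.smul_fst, Prod.smul_snd, Pi.smul_apply, smul_eq_mul, RingHom.id_apply,
      Finset.mul_sum, mul_sub]
    simp only [← Finset.mul_sum]
    ring_nf
    simp only [Finset.mul_sum]
    ring_nf

/-- Unfolding lemma. [folklore] -/
@[simp] theorem tcovLowerₗ_apply (x : E) (j k : ι) (I : α → ι)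
    (UP : ((α → ι) → ℝ) × (ι → (α → ι) → ℝ)) :
    tcovLowerₗ G b x j k I UP = tcovLower G b x UP.1 UP.2 j k I := rfl

variable [FiniteDimensional ℝ E]

/-- The lower-order part of `(□T)_I` as a linear functional of the jet `(U, P)`.
[cite: ONeill1983, Ch. 3, Def. 3.50] -/
def tlapLowerₗ (x : E) (I : α → ι) : (((α → ι) → ℝ) × (ι → (α → ι) → ℝ)) →ₗ[ℝ] ℝ :=
  ∑ j, ∑ k, ginv G b x j k • tcovLowerₗ G b x j k I

/-- Unfolding lemma. [folklore] -/
@[simp] theorem tlapLowerₗ_apply (x : E) (I : α → ι) (UP : ((α → ι) → ℝ) × (ι → (α → ι) → ℝ)) :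
    tlapLowerₗ G b x I UP = tlapLower G b x UP.1 UP.2 I := by
  simp [tlapLowerₗ, tlapLower]

variable [DecidableEq ι]

/-- **The zeroth-order coefficients** `L⁰_{IJ}(x)` of `(□T)_I`: the lower-order part on the jet
`(δ_J, 0)`. [cite: ONeill1983, Ch. 3, Def. 3.50] -/
def lowerCoef0 (x : E) (I J : α → ι) : ℝ :=
  tlapLower G b x (fun J' ↦ if J = J' then 1 else 0) 0 I

/-- **The first-order coefficients** `Lᵐ_{IJ}(x)` of `(□T)_I`: the lower-order part on the jet
`(0, δ_{(m,J)})`. [cite: ONeill1983, Ch. 3, Def. 3.50] -/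
def lowerCoef1 (x : E) (I : α → ι) (m : ι) (J : α → ι) : ℝ :=
  tlapLower G b x 0 (fun m' J' ↦ if (m, J) = (m', J') then 1 else 0) I

/-- **Expansion of the lower-order part in the jets**:
`tlapLower x U P I = Σ_J U_J L⁰_{IJ}(x) + Σ_m Σ_J P_{mJ} Lᵐ_{IJ}(x)`. [cite: ONeill1983, Ch. 3, Def. 3.50] -/
theorem tlapLower_eq_sum (x : E) (U : (α → ι) → ℝ) (P : ι → (α → ι) → ℝ)
    (I : α → ι) :
    tlapLower G b x U P I =
      ∑ J, U J * lowerCoef0 G b x I J + ∑ m, ∑ J, P m J * lowerCoef1 G b x I m J := by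
  set ℓ := tlapLowerₗ G b x I with hℓ
  have hsplit : tlapLower G b x U P I = ℓ (U, 0) + ℓ (0, P) := by
    rw [← map_add, Prod.mk_add_mk, add_zero, zero_add, hℓ, tlapLowerₗ_apply]
  -- the `U`-part
  have hU : ℓ (U, 0) = ∑ J, U J * lowerCoef0 G b x I J := by
    have h := LinearMap.pi_apply_eq_sum_univ (ℓ.comp (LinearMap.inl ℝ _ _)) U
    simp only [LinearMap.comp_apply, LinearMap.inl_apply, smul_eq_mul] at h
    rw [h]
    refine Finset.sum_congr rfl fun J _ ↦ ?_
    rw [hℓ, tlapLowerₗ_apply]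
    rfl
  -- the `P`-part
  have hP : ℓ (0, P) = ∑ m, ∑ J, P m J * lowerCoef1 G b x I m J := by
    set g := (ℓ.comp (LinearMap.inr ℝ _ _)).comp
      (LinearEquiv.curry ℝ ℝ ι (α → ι)).toLinearMap with hg
    have hPc : P = Function.curry (Function.uncurry P) := (Function.curry_uncurry P).symm
    have h := LinearMap.pi_apply_eq_sum_univ g (Function.uncurry P)
    have hgP : g (Function.uncurry P) = ℓ (0, P) := by
      simp only [hg, LinearMap.comp_apply, LinearEquiv.coe_toLinearMap, LinearEquiv.coe_curry,
        LinearMap.inr_apply]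
      rw [← hPc]
    rw [← hgP, h, Fintype.sum_prod_type]
    refine Finset.sum_congr rfl fun m _ ↦ Finset.sum_congr rfl fun J _ ↦ ?_
    simp only [hg, LinearMap.comp_apply, LinearEquiv.coe_toLinearMap, LinearEquiv.coe_curry,
      LinearMap.inr_apply, Function.uncurry_apply_pair, smul_eq_mul, hℓ, tlapLowerₗ_apply]
    rfl
  rw [hsplit, hU, hP]

/-- The zeroth-order coefficients are smooth on `V`. [folklore] -/
theorem IsMetricOn.contDiffOn_lowerCoef0 [CompleteSpace E] {V : Set E} (hG : IsMetricOn G V)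
    (I J : α → ι) : ContDiffOn ℝ ∞ (fun x ↦ lowerCoef0 G b x I J) V := by
  have hc := hG.contDiffOn_tlapLower (b := b) (α := α) I
  set jet : LapJet ι α := ((fun J' ↦ if J = J' then (1 : ℝ) else 0), (0 : ι → (α → ι) → ℝ))
    with hjet
  have hmap : ContDiffOn ℝ ∞ (fun x : E ↦ ((x, jet) : E × LapJet ι α)) V :=
    contDiffOn_id.prodMk contDiffOn_const
  have hto : MapsTo (fun x : E ↦ ((x, jet) : E × LapJet ι α)) V (V ×ˢ univ) := fun x hx ↦
    mk_mem_prod hx (mem_univ _)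
  have h3 := ContDiffOn.comp hc hmap hto
  unfold lowerCoef0
  exact h3

/-- The first-order coefficients are smooth on `V`. [folklore] -/
theorem IsMetricOn.contDiffOn_lowerCoef1 [CompleteSpace E] {V : Set E} (hG : IsMetricOn G V)
    (I : α → ι) (m : ι) (J : α → ι) : ContDiffOn ℝ ∞ (fun x ↦ lowerCoef1 G b x I m J) V := by
  have hc := hG.contDiffOn_tlapLower (b := b) (α := α) I
  set jet : LapJet ι α := ((0 : (α → ι) → ℝ), (fun m' J' ↦ if (m, J) = (m', J') then (1 : ℝ) else 0))
    with hjet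
  have hmap : ContDiffOn ℝ ∞ (fun x : E ↦ ((x, jet) : E × LapJet ι α)) V :=
    contDiffOn_id.prodMk contDiffOn_const
  have hto : MapsTo (fun x : E ↦ ((x, jet) : E × LapJet ι α)) V (V ×ˢ univ) := fun x hx ↦
    mk_mem_prod hx (mem_univ _)
  have h3 := ContDiffOn.comp hc hmap hto
  unfold lowerCoef1
  exact h3

end Linear

/-! ### Locality: metrics which agree on an open set have the same operators there -/

section Locality

variable [Fintype ι] [FiniteDimensional ℝ E] (b : Basis ι ℝ E) {G G' : E → E →L[ℝ] E →L[ℝ] ℝ}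
  {U : Set E} {x : E}

/-- The Ricci form at `x` only depends on the components on an open set around `x`. [folklore] -/
theorem ricAt_congr_of_eqOn (hU : IsOpen U) (h : ∀ y ∈ U, G y = G' y)
    (hx : x ∈ U) : ricAt G x = ricAt G' x := by
  ext Y Z
  rw [ricAt_apply, ricAt_apply]
  congr 1
  ext X
  simp [riemAt_congr_of_eqOn hU h hx]

variable {α : Type*} [Fintype α] [DecidableEq α]

/-- **`□T` at `x` only depends on the metric components on an open set around `x`.** [folklore] -/
theorem tlap_congr_of_eqOn (hU : IsOpen U) (hG : ∀ y ∈ U, G y = G' y)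
    (hx : x ∈ U) (T : E → (α → ι) → ℝ) (I : α → ι) :
    tlap G b T x I = tlap G' b T x I := by
  rw [tlap_apply, tlap_apply]
  refine Finset.sum_congr rfl fun j _ ↦ Finset.sum_congr rfl fun k _ ↦ ?_
  -- the inverse coefficients only depend on the value at `x` (cf. `ginv_congr_pt`)
  have hginv : ginv G b x j k = ginv G' b x j k := by simp [ginv, sharpAt, hG x hx]
  rw [hginv, tcov_congr_of_eqOn (b := b) hU hG (T := tcov G b T) (T' := tcov G' b T)
      (fun y hy K ↦ tcov_congr_of_eqOn (b := b) hU hG (fun _ _ _ ↦ rfl) hy K) hx]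

end Locality

/-! ### Vanishing of the lower-order terms where the metric is locally constant -/

section Flat

variable {G : E → E →L[ℝ] E →L[ℝ] ℝ} {x : E} {M : E →L[ℝ] E →L[ℝ] ℝ}

/-- Where the metric is locally constant the Christoffel map vanishes. [folklore] -/
theorem chrAt_eq_zero_of_eventuallyEq_const (h : G =ᶠ[𝓝 x] fun _ ↦ M) : chrAt G x = 0 := by
  unfold chrAt koszulCLM
  rw [h.fderiv_eq]
  simp

variable [Fintype ι] (b : Basis ι ℝ E)

omit [Fintype ι] in
/-- Where the metric is locally constant the Christoffel symbols vanish. [folklore] -/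
theorem chrCoef_eq_zero_of_eventuallyEq_const (h : G =ᶠ[𝓝 x] fun _ ↦ M) (j i m : ι) :
    chrCoef G b x j i m = 0 := by
  simp [chrCoef, chrAt_eq_zero_of_eventuallyEq_const h]

omit [Fintype ι] in
/-- Where the metric is locally constant the derivatives of the Christoffel symbols vanish.
[folklore] -/
theorem fderiv_chrCoef_eq_zero_of_eventuallyEq_const (h : G =ᶠ[𝓝 x] fun _ ↦ M) (j i m : ι) :
    fderiv ℝ (fun y ↦ chrCoef G b y j i m) x = 0 := by
  have hev : (fun y ↦ chrCoef G b y j i m) =ᶠ[𝓝 x] fun _ ↦ (0 : ℝ) :=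
    h.eventuallyEq_nhds.mono fun _ hy ↦ chrCoef_eq_zero_of_eventuallyEq_const b hy j i m
  rw [hev.fderiv_eq]
  simp

variable {α : Type*} [Fintype α] [DecidableEq α]

/-- Where the metric is locally constant the lower-order part of `∇∇` vanishes. [folklore] -/
theorem tcovLower_eq_zero_of_eventuallyEq_const (h : G =ᶠ[𝓝 x] fun _ ↦ M)
    (U : (α → ι) → ℝ) (P : ι → (α → ι) → ℝ) (j k : ι) (I : α → ι) :
    tcovLower G b x U P j k I = 0 := by
  simp [tcovLower, chrCoef_eq_zero_of_eventuallyEq_const b h,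
    fderiv_chrCoef_eq_zero_of_eventuallyEq_const b h]

variable [FiniteDimensional ℝ E]

/-- Where the metric is locally constant the lower-order part of `□` vanishes. [folklore] -/
theorem tlapLower_eq_zero_of_eventuallyEq_const (h : G =ᶠ[𝓝 x] fun _ ↦ M)
    (U : (α → ι) → ℝ) (P : ι → (α → ι) → ℝ) (I : α → ι) :
    tlapLower G b x U P I = 0 := by
  simp [tlapLower, tcovLower_eq_zero_of_eventuallyEq_const b h]

/-- Where the metric is locally constant the zeroth-order coefficients vanish. [folklore] -/
theorem lowerCoef0_eq_zero_of_eventuallyEq_const [DecidableEq ι] (h : G =ᶠ[𝓝 x] fun _ ↦ M)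
    (I J : α → ι) : lowerCoef0 G b x I J = 0 :=
  tlapLower_eq_zero_of_eventuallyEq_const b h _ _ I

/-- Where the metric is locally constant the first-order coefficients vanish. [folklore] -/
theorem lowerCoef1_eq_zero_of_eventuallyEq_const [DecidableEq ι] (h : G =ᶠ[𝓝 x] fun _ ↦ M)
    (I : α → ι) (m : ι) (J : α → ι) : lowerCoef1 G b x I m J = 0 :=
  tlapLower_eq_zero_of_eventuallyEq_const b h _ _ I

end Flat

/-! ### The Schur complement identity of the slice metric -/

section Schur

variable [Fintype ι] [DecidableEq ι] [FiniteDimensional ℝ E] (b : Basis (Option ι) ℝ E)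
  {G : E → E →L[ℝ] E →L[ℝ] ℝ} {x : E}

omit [Fintype ι] [FiniteDimensional ℝ E] in
/-- Coordinates of basis vectors. [folklore] -/
theorem coord_basis (a c : Option ι) : b.coord a (b c) = if c = a then 1 else 0 := by
  rw [Basis.coord_apply, b.repr_self, Finsupp.single_apply]

/-- **The Schur complement identity**: in a basis indexed by `Option ι` (`none` = time) with
`g⁰⁰ ≠ 0`, `Σ_j g_{kj} (g^{ji} − g^{0j} g^{0i} / g⁰⁰) = δ_{ki}` — the spatial symbol
`Q = (g^{jk} − g^{0j}g^{0k}/g⁰⁰)` is the inverse of the spatial block `(g_{jk})` (the induced metric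
of the slices `{t = const}`). [cite: HawkingEllis1973CUP, §2.7] -/
theorem sum_metric_mul_sliceQ (hx : (G x).IsInvertible) (hs : ∀ v w : E, G x v w = G x w v)
    (h00 : ginv G b x none none ≠ 0) (k i : ι) :
    ∑ j, G x (b (some k)) (b (some j)) *
        (ginv G b x (some j) (some i)
          - ginv G b x none (some j) * ginv G b x none (some i) / ginv G b x none none) =
      if k = i then 1 else 0 := by
  have hgs : ∀ a c, ginv G b x a c = ginv G b x c a := fun a c ↦ ginv_comm b hx hs a c
  -- the two coordinate identities `δ = Σ_μ g^{aμ} g_{kμ}` for `a = some i` and `a = none`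
  have h1 := coord_eq_sum_ginv b hx (b (some k)) (some i)
  have h2 := coord_eq_sum_ginv b hx (b (some k)) none
  rw [coord_basis, Fintype.sum_option] at h1 h2
  simp only [Option.some.injEq, reduceCtorEq, if_false] at h1 h2
  -- notation
  set g00 := ginv G b x none none
  set G0 := G x (b (some k)) (b none)
  have hS2 : ∑ j, ginv G b x none (some j) * G x (b (some k)) (b (some j)) = -(g00 * G0) := by
    linarith
  have hS1 : ∑ j, ginv G b x (some i) (some j) * G x (b (some k)) (b (some j)) =
      (if k = i then 1 else 0) - ginv G b x (some i) none * G0 := by linarith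
  -- expand the left-hand side
  have hL : ∑ j, G x (b (some k)) (b (some j)) *
      (ginv G b x (some j) (some i)
        - ginv G b x none (some j) * ginv G b x none (some i) / g00) =
      (∑ j, ginv G b x (some i) (some j) * G x (b (some k)) (b (some j)))
        - (∑ j, ginv G b x none (some j) * G x (b (some k)) (b (some j)))
          * (ginv G b x (some i) none * g00⁻¹) := by
    rw [Finset.sum_mul, ← Finset.sum_sub_distrib]
    refine Finset.sum_congr rfl fun j _ ↦ ?_
    rw [hgs (some j) (some i), hgs none (some i)]
    ring
  rw [hL, hS1, hS2]
  field_simp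
  ring

end Schur

end MetricCoord

end Literature.Geometry.Lorentzian

end
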